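import Summits.QuantumFields.YangMills.Theses.FemtoCutoffLadder
import Summits.QuantumFields.YangMills.Theorems.FemtoCutoffLadderOctaveStepDecayStubExcitedRatioUpper

/-!
# Crux `OctaveStepDecay` (stmt-QuantumFields-24153) — the registered `trace` line is an EXACT reformulation:
# `TowerTraceComparison ↔ OctaveStepDecay`, kernel-checked in both directions

Seat `ym-line-fcl-p3` (2026-08-28; explicit-unit prover seat of route `FemtoCutoffLadder`, keyed row stmt-QuantumFields-23836
`stub_octavePairs` — closed·moot, superseded by this crux).  Rung R2b1 = the RECORD-label femto transfer gap `FemtoGapOfRecord`: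
NOT the Clay gap, not infinite volume, no summit.

The registered skeleton `Cruxes.OctaveStepDecay.Trace` (planner ym-idea-1 g2, evidence `OctaveStepDecay_trace_skeleton.lean`) reduces the
crux to two stubs: `stub_excitedRatioUpper : ExcitedRatioUpper` (LANDED, `FemtoCutoffLadderOctaveStepDecayStubExcitedRatioUpper.lean`) and the
HARD stub `stub_towerTraceComparison : TowerTraceComparison` (`FemtoCutoffLadderTraceDefs.lean`: along one dyadic tower `L' = L₀·2^i`,
`L = 2L'`, at matched two-loop label, the fine zero-flux EXCITED TRACE RATIO `E(L,β,2T) = Z_phys(2T)/λ₀^{2T} − 1` is bounded by the coarse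
`E(L',β',T)` up to `M·exp(s·T/L')`, `s = CΛ²/L'^σ + D(1/β' − 1/β)`).  This file records, sorry-free:

* `octaveStepDecay_of_towerTraceComparison : TowerTraceComparison → OctaveStepDecay` — the skeleton's composition with the landed stub
  discharged (`(λ₁/λ₀)^T ≤ E(T) ≤ (λ₁/λ₀)^{T−2}E(2)` and the root test `T → ∞`; proof adapted from the planner's registered skeleton);
* `towerTraceComparison_of_octaveStepDecay : OctaveStepDecay → TowerTraceComparison` — the CONVERSE: the eigenvalue inequality
  `(λ₁/λ₀)_f^{2L'} ≤ e^{s}·(λ₁/λ₀)_c^{L'}` gives, after `L'`-th roots, `E_f(2T) ≤ (λ₁/λ₀)_f^{2T−2}E_f(2) ≤ M·e^{sT/L'}·E_c(T)` for every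
  `T ≥ 2` with the explicit prefactor `M = E_f(2)/(e^{s/L'}·(λ₁/λ₀)_c)`;
* ★ `towerTraceComparison_iff : TowerTraceComparison ↔ OctaveStepDecay`.

READING FOR THE PLANNER (D-0014): the `trace` line's single open stub is the crux itself modulo fixed-lattice spectral bookkeeping that is
already in the tree (trace formula, positivity of the levels) — difficulty reduction ZERO; the stub sits behind
`Literature.Barriers.QuantumFields.UVStabilityNonUniqueness` exactly as the crux does (the tree holds no Wilson(`L'`)-vs-Wilson(`2L'`)
comparison map, block-spin interpolation or small-field / large-field decomposition on the asymmetric tori).  HONEST FRAMING: nothing in this file is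
a two-cutoff estimate; no definitions, no named facts, no `sorry`.
-/

set_option autoImplicit false

noncomputable section

namespace Summit.QuantumFields.YangMills.Theorems.FemtoCutoffLadder.Trace

open Real
open Summit.QuantumFields.YangMills.Theorems.FemtoTransferGap
open Summit.QuantumFields.YangMills.Theses.FemtoCutoffLadder

/-! ### §1. Fixed-lattice facts about the excited trace ratio `E(L,β,T)` (tree, restated in the `excitedRatio` vocabulary) -/

section OneLattice

variable {L : ℕ} [NeZero L]

/-- `(λ₁/λ₀)^T ≤ E(T)` on the femto window for `T ≥ 2`: the excited trace ratio dominates its first term (all other terms of the trace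
formula are non-negative). [cite: MontvayMunster1994, (3.145)] -/
theorem excitedRatio_lower {lam β : ℝ} (hW : InFemtoWindow lam β L) {T : ℕ} (hT : 2 ≤ T) :
    (secondValue su2Rep L β / topValue su2Rep L β) ^ T ≤ excitedRatio L β T := by
  unfold excitedRatio
  exact physTrace_excited_lower hW hT

/-- `E(T) ≤ (λ₁/λ₀)^{T−2}·E(2)` on the femto window for `T ≥ 2` — the landed registered stub `stub_excitedRatioUpper`, by name.
[cite: ReedSimonIV1978, Thm. XIII.1] -/
theorem excitedRatio_upper {lam β : ℝ} (hW : InFemtoWindow lam β L) {T : ℕ} (hT : 2 ≤ T) :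
    excitedRatio L β T ≤ (secondValue su2Rep L β / topValue su2Rep L β) ^ (T - 2) * excitedRatio L β 2 :=
  Summit.QuantumFields.YangMills.Cruxes.OctaveStepDecay.Trace.stub_excitedRatioUpper lam L β T hW hT

/-- On the femto window the spectral ratio `λ₁/λ₀` is positive (strictly positive-definite kernel). [folklore] -/
theorem ratio_pos_of_window {lam β : ℝ} (hW : InFemtoWindow lam β L) :
    0 < secondValue su2Rep L β / topValue su2Rep L β :=
  div_pos (secondValue_su2Rep_pos (by linarith [hW.1])) (topValue_su2Rep_pos L β)

/-- On the femto window the excited trace ratio is positive for `T ≥ 2`. [folklore] -/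
theorem excitedRatio_pos {lam β : ℝ} (hW : InFemtoWindow lam β L) {T : ℕ} (hT : 2 ≤ T) :
    0 < excitedRatio L β T :=
  lt_of_lt_of_le (pow_pos (ratio_pos_of_window hW) T) (excitedRatio_lower hW hT)

end OneLattice

/-! ### §2. Two pieces of real-number bookkeeping -/

/-- Root test: if `a^T ≤ K·b^T` for all `T ≥ T₁` with `a ≥ 0`, `b > 0`, then `a ≤ b` (a subexponential prefactor never beats a ratio `> 1`).
[folklore] -/
theorem le_of_pow_le_mul_pow {a b K : ℝ} {T1 : ℕ} (ha : 0 ≤ a) (hb : 0 < b)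
    (h : ∀ T : ℕ, T1 ≤ T → a ^ T ≤ K * b ^ T) : a ≤ b := by
  by_contra hlt
  push Not at hlt
  have hx : 1 < a / b := by rw [lt_div_iff₀ hb, one_mul]; exact hlt
  have hx1 : 1 ≤ a / b := hx.le
  obtain ⟨n, hn⟩ := pow_unbounded_of_one_lt K hx
  have hT := h (n + T1) (Nat.le_add_left _ _)
  have hbT : 0 < b ^ (n + T1) := pow_pos hb _
  have h1 : (a / b) ^ (n + T1) ≤ K := by
    rw [div_pow, div_le_iff₀ hbT]; exact hT
  have h2 : (a / b) ^ n ≤ (a / b) ^ (n + T1) := pow_le_pow_right₀ hx1 (Nat.le_add_right _ _)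
  have _ := ha
  linarith

/-- Cross-multiplied form versus ratio form of a comparison of two spectral ratios: for `Y, Y' > 0`,
`X·Y' ≤ E·(X'·Y) ↔ X/Y ≤ E·(X'/Y')`. [folklore] -/
theorem cross_le_iff {X Y X' Y' E : ℝ} (hY : 0 < Y) (hY' : 0 < Y') :
    X * Y' ≤ E * (X' * Y) ↔ X / Y ≤ E * (X' / Y') := by
  rw [mul_div_assoc', div_le_div_iff₀ hY hY', mul_assoc]

/-! ### §3. `TowerTraceComparison → OctaveStepDecay` (the skeleton's composition, landed stub discharged) -/

/-- **Stub ⇒ crux** (the registered skeleton's composition `octaveStepDecay_of_parts` with `ExcitedRatioUpper` discharged by the landed stub):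
chain `(λ₁/λ₀)_f^{2T} ≤ E_f(2T) ≤ M e^{sT/L'} E_c(T) ≤ M e^{sT/L'} (λ₁/λ₀)_c^{T−2} E_c(2)`, take the `T`-th root in the limit (root test), raise
to the `L'`-th power and clear denominators.  Proof adapted from the planner's registered skeleton `OctaveStepDecay_trace_skeleton.lean`.
[cite: MontvayMunster1994, (3.145)] [cite: ReedSimonIV1978, Thm. XIII.1] -/
theorem octaveStepDecay_of_towerTraceComparison (h1 : TowerTraceComparison) : OctaveStepDecay := by
  obtain ⟨C, σ, D, lam0, L0, hL0, hσ, hlam0, hD, H⟩ := h1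
  refine ⟨C, σ, D, lam0, L0, hL0, hσ, hlam0, hD, ?_⟩
  intro lam hlam hle i L' _ L _ hL' hL β β' hW hW' hm
  obtain ⟨M, T0, HT⟩ := H lam hlam hle i L' L hL' hL β β' hW hW' hm
  -- notation and positivity
  set s : ℝ := slack C σ D β β' L L' with hsdef
  have hbf : 0 < topValue su2Rep L β := topValue_su2Rep_pos L β
  have hbc : 0 < topValue su2Rep L' β' := topValue_su2Rep_pos L' β'
  set rf : ℝ := secondValue su2Rep L β / topValue su2Rep L β with hrfdef
  set rc : ℝ := secondValue su2Rep L' β' / topValue su2Rep L' β' with hrcdef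
  have hrf : 0 < rf := ratio_pos_of_window hW
  have hrc : 0 < rc := ratio_pos_of_window hW'
  have hL'pos : (0 : ℝ) < (L' : ℝ) := by exact_mod_cast Nat.pos_of_ne_zero (NeZero.ne L')
  set E2 : ℝ := excitedRatio L' β' 2 with hE2def
  have hE2 : 0 < E2 := excitedRatio_pos hW' le_rfl
  set T1 : ℕ := max T0 2 with hT1def
  -- the chained bound for T ≥ T1:  rf^(2T) ≤ M e^{sT/L'} rc^(T-2) E2
  have hchain : ∀ T : ℕ, T1 ≤ T →
      rf ^ (2 * T) ≤ M * Real.exp (s * T / L') * (rc ^ (T - 2) * E2) := by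
    intro T hT
    have hT0 : T0 ≤ T := le_trans (le_max_left _ _) hT
    have hT2 : 2 ≤ T := le_trans (le_max_right _ _) hT
    have h2T : 2 ≤ 2 * T := by omega
    have hlow := excitedRatio_lower (T := 2 * T) hW h2T
    have hmid := HT T hT0
    have hup := excitedRatio_upper hW' hT2
    have hEc : 0 < excitedRatio L' β' T := excitedRatio_pos hW' hT2
    have hMe : 0 ≤ M * Real.exp (s * T / L') := by
      have hpos : 0 < M * Real.exp (s * T / L') * excitedRatio L' β' T :=
        lt_of_lt_of_le (lt_of_lt_of_le (pow_pos hrf _) hlow) hmid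
      by_contra hneg
      push Not at hneg
      have : M * Real.exp (s * T / L') * excitedRatio L' β' T ≤ 0 :=
        mul_nonpos_of_nonpos_of_nonneg hneg.le hEc.le
      linarith
    calc rf ^ (2 * T) ≤ excitedRatio L β (2 * T) := hlow
      _ ≤ M * Real.exp (s * T / L') * excitedRatio L' β' T := hmid
      _ ≤ M * Real.exp (s * T / L') * (rc ^ (T - 2) * E2) := mul_le_mul_of_nonneg_left hup hMe
  -- rewrite as (rf²)^T ≤ K · (e^{s/L'} rc)^T with K = |M| E2 / rc²
  have hkey : ∀ T : ℕ, T1 ≤ T →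
      (rf ^ 2) ^ T ≤ (|M| * E2 / rc ^ 2) * (Real.exp (s / L') * rc) ^ T := by
    intro T hT
    have hT2 : 2 ≤ T := le_trans (le_max_right _ _) hT
    have h := hchain T hT
    have hpow : rc ^ (T - 2) = rc ^ T / rc ^ 2 := by
      rw [eq_div_iff (pow_pos hrc 2).ne', ← pow_add, Nat.sub_add_cancel hT2]
    have hexp : Real.exp (s * T / L') = Real.exp (s / L') ^ T := by
      rw [← Real.exp_nat_mul]; congr 1; ring
    rw [hpow, hexp] at h
    have hM : M ≤ |M| := le_abs_self M
    have hnn : 0 ≤ Real.exp (s / L') ^ T * (rc ^ T / rc ^ 2 * E2) := by positivity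
    calc (rf ^ 2) ^ T = rf ^ (2 * T) := by rw [pow_mul]
      _ ≤ M * Real.exp (s / L') ^ T * (rc ^ T / rc ^ 2 * E2) := h
      _ = M * (Real.exp (s / L') ^ T * (rc ^ T / rc ^ 2 * E2)) := by ring
      _ ≤ |M| * (Real.exp (s / L') ^ T * (rc ^ T / rc ^ 2 * E2)) := mul_le_mul_of_nonneg_right hM hnn
      _ = (|M| * E2 / rc ^ 2) * (Real.exp (s / L') * rc) ^ T := by
          rw [mul_pow]; field_simp
  -- root test
  have hroot : rf ^ 2 ≤ Real.exp (s / L') * rc :=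
    le_of_pow_le_mul_pow (sq_nonneg rf) (mul_pos (Real.exp_pos _) hrc) hkey
  -- raise to the L'-th power: rf^L ≤ e^s rc^{L'}
  have hpowL : rf ^ L ≤ Real.exp s * rc ^ L' := by
    have h := pow_le_pow_left₀ (sq_nonneg rf) hroot L'
    rw [← pow_mul, mul_pow, ← Real.exp_nat_mul] at h
    have hsL : (L' : ℝ) * (s / L') = s := by field_simp
    rw [hsL] at h
    have hLL : 2 * L' = L := by omega
    rw [hLL] at h
    exact h
  -- back to the cross-multiplied form of the crux
  have hcross : secondValue su2Rep L β ^ L * topValue su2Rep L' β' ^ L' ≤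
      Real.exp s * (secondValue su2Rep L' β' ^ L' * topValue su2Rep L β ^ L) := by
    rw [hrfdef, hrcdef, div_pow, div_pow] at hpowL
    exact (cross_le_iff (pow_pos hbf L) (pow_pos hbc L')).2 hpowL
  simpa only [hsdef, slack] using hcross

/-! ### §4. `OctaveStepDecay → TowerTraceComparison` (the converse) and the equivalence -/

/-- **Crux ⇒ stub (converse)**: from `λ₁(β,L)^L·λ₀(β',L')^{L'} ≤ e^{s}·λ₁(β',L')^{L'}·λ₀(β,L)^L` with `L = 2L'`, the `L'`-th root gives
`(λ₁/λ₀)_f² ≤ e^{s/L'}·(λ₁/λ₀)_c`; with `E_f(2T) ≤ (λ₁/λ₀)_f^{2T−2}·E_f(2)` and `(λ₁/λ₀)_c^T ≤ E_c(T)` this is the tower trace comparison for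
every `T ≥ 2` with `M = E_f(2)/(e^{s/L'}·(λ₁/λ₀)_c)` — same constants `C, σ, D, lam₀, L₀`. [cite: MontvayMunster1994, (3.145)]
[cite: ReedSimonIV1978, Thm. XIII.1] -/
theorem towerTraceComparison_of_octaveStepDecay (h : OctaveStepDecay) : TowerTraceComparison := by
  obtain ⟨C, σ, D, lam0, L0, hL0, hσ, hlam0, hD, H⟩ := h
  refine ⟨C, σ, D, lam0, L0, hL0, hσ, hlam0, hD, ?_⟩
  intro lam hlam hle i L' _ L _ hL' hL β β' hW hW' hm
  have hstep := H lam hlam hle i L' L hL' hL β β' hW hW' hm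
  -- notation and positivity
  set s : ℝ := slack C σ D β β' L L' with hsdef
  have hbf : 0 < topValue su2Rep L β := topValue_su2Rep_pos L β
  have hbc : 0 < topValue su2Rep L' β' := topValue_su2Rep_pos L' β'
  set rf : ℝ := secondValue su2Rep L β / topValue su2Rep L β with hrfdef
  set rc : ℝ := secondValue su2Rep L' β' / topValue su2Rep L' β' with hrcdef
  have hrc : 0 < rc := ratio_pos_of_window hW'
  have hL'pos : (0 : ℝ) < (L' : ℝ) := by exact_mod_cast Nat.pos_of_ne_zero (NeZero.ne L')
  -- Step 1: ratio form of the crux inequality, `rf^L ≤ e^s · rc^{L'}`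
  have hcross : secondValue su2Rep L β ^ L * topValue su2Rep L' β' ^ L' ≤
      Real.exp s * (secondValue su2Rep L' β' ^ L' * topValue su2Rep L β ^ L) := by
    simpa only [hsdef, slack] using hstep
  have hpowL : rf ^ L ≤ Real.exp s * rc ^ L' := by
    rw [hrfdef, hrcdef, div_pow, div_pow]
    exact (cross_le_iff (pow_pos hbf L) (pow_pos hbc L')).1 hcross
  -- Step 2: `L'`-th root, `rf² ≤ e^{s/L'} · rc`
  have hroot : rf ^ 2 ≤ Real.exp (s / L') * rc := by
    have h1 : (rf ^ 2) ^ L' ≤ (Real.exp (s / L') * rc) ^ L' := by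
      have hLL : 2 * L' = L := by omega
      have hsL : (L' : ℝ) * (s / L') = s := by field_simp
      rw [← pow_mul, mul_pow, ← Real.exp_nat_mul, hLL, hsL]
      exact hpowL
    exact (pow_le_pow_iff_left₀ (sq_nonneg rf) (mul_pos (Real.exp_pos _) hrc).le (NeZero.ne L')).1 h1
  -- Step 3: the trace comparison for every `T ≥ 2`
  refine ⟨excitedRatio L β 2 / (Real.exp (s / L') * rc), 2, fun T hT => ?_⟩
  set q : ℝ := Real.exp (s / L') * rc with hqdef
  have hq : 0 < q := mul_pos (Real.exp_pos _) hrc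
  have hEf2 : 0 < excitedRatio L β 2 := excitedRatio_pos hW le_rfl
  have hEc : rc ^ T ≤ excitedRatio L' β' T := excitedRatio_lower hW' hT
  have h2T : 2 ≤ 2 * T := by omega
  have hup : excitedRatio L β (2 * T) ≤ (rf ^ 2) ^ (T - 1) * excitedRatio L β 2 := by
    have h := excitedRatio_upper hW h2T
    have he : rf ^ (2 * T - 2) = (rf ^ 2) ^ (T - 1) := by
      rw [← pow_mul]; congr 1; omega
    rw [he] at h
    exact h
  have hmid : (rf ^ 2) ^ (T - 1) ≤ q ^ (T - 1) := pow_le_pow_left₀ (sq_nonneg rf) hroot (T - 1)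
  have hexp : Real.exp (s * T / L') = Real.exp (s / L') ^ T := by
    rw [← Real.exp_nat_mul]; congr 1; ring
  have hqT : q ^ T = q ^ (T - 1) * q := by
    rw [← pow_succ]; congr 1; omega
  rw [hexp]
  calc excitedRatio L β (2 * T) ≤ (rf ^ 2) ^ (T - 1) * excitedRatio L β 2 := hup
    _ ≤ q ^ (T - 1) * excitedRatio L β 2 := mul_le_mul_of_nonneg_right hmid hEf2.le
    _ = excitedRatio L β 2 / q * (Real.exp (s / L') ^ T * rc ^ T) := by
        rw [← mul_pow, ← hqdef, hqT, div_mul_eq_mul_div, eq_div_iff hq.ne']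
        ring
    _ ≤ excitedRatio L β 2 / q * (Real.exp (s / L') ^ T * excitedRatio L' β' T) :=
        mul_le_mul_of_nonneg_left (mul_le_mul_of_nonneg_left hEc (pow_nonneg (Real.exp_pos _).le T))
          (div_pos hEf2 hq).le
    _ = excitedRatio L β 2 / q * Real.exp (s / L') ^ T * excitedRatio L' β' T := by ring

/-- ★ **The `trace` line of crux `OctaveStepDecay` is an exact reformulation**: `TowerTraceComparison ↔ OctaveStepDecay` (same constants
`C, σ, D, lam₀, L₀` both ways).  Difficulty reduction of the registered skeleton's open stub relative to the crux: none.
[cite: MontvayMunster1994, (3.145)] -/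
theorem towerTraceComparison_iff : TowerTraceComparison ↔ OctaveStepDecay :=
  ⟨octaveStepDecay_of_towerTraceComparison, towerTraceComparison_of_octaveStepDecay⟩

end Summit.QuantumFields.YangMills.Theorems.FemtoCutoffLadder.Trace

end
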